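import Summits.QuantumFields.BalabanUV.T4Continuum.Support.RegularTransportersContour
import Summits.QuantumFields.BalabanUV.T4Continuum.Support.NestedContourTransportBound
import Summits.QuantumFields.BalabanUV.T4Continuum.Support.GaugeTermDecomposition

/-!
# T⁴ programme, spine node NE2 (U1a), tier B — ROW B5 × ROW B3.b-conc FEED: the SITE TRANSPORTERS `T^{(k)}(x) = R^{(k)}(Γ_{y,x})` of the
# scalar covariant averaging, DETERMINED by the bond transporters, with their size and two-level consistency from the regularity class and
# node NE3 BY NAME

NE2 formalisation swarm, leaf prover 03 (row B5 of `t4/formal/NE2/LEAVES.md`).  In leaf-05's `Support/GaugeTermInstance.perturbationLaws_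
gaugeTerm_balaban` and leaf-08's `Spine/NE2BalabanClosure` the site transports `T : (k : ℕ) → Tor (fine (lev L k) M) → Matrix o o ℂ` of the
transported scalar averaging `Q′(U) = (Q′ ⊗ 1)·siteMul T` ([Balaban1985BackgroundPropagators] (3.19) p.393, SHAPE «(Q′(V)λ)(y) = Σ_{x∈B(y)}
L^{−d}R(V(Γ_{y,x}))λ(x)») are free DATA with displayed binders `hT : ∀ k, ‖siteMul (T k) − 1‖ ≤ τ` and
`hTc : ∀ k, ‖siteMul (T (k+1)) − siteMul (fun x′ => T k (par x′))‖ ≤ δT k`.  This file CONSTRUCTS them from site-based bond transporters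
`Rg : (k : ℕ) → Fin d → Tor (fine (lev L k) M) → Matrix o o ℂ` and DISCHARGES both binders from
`hreg : RegularTransporters L M (fun k => liftR (fine (lev L k) M) (Rg k)) α β` (row B5; `liftR` = leaf-10's slot lift, the same term as
leaf-08's `NE2BalabanGauge.liftR L M Rg`) and `hNE3 : LocalRate (bgReadings L M (regClass L M (fun k => liftR … (Rg k)))) C L⁻¹` (node NE3 BY
NAME on the class `{w, Dw}` of THAT tower — no transporter tower is added to the class):
 * §1 the block decomposition `bdec n M x = (y, j)` with `x = n·y + j` (inverse of `B5Block118.bpt` via `B5Blocks16.bpt_bijective`),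
   `unglue` (inverse of leaf-06's `glue`), **`par_bpt_glue`** (`par (bpt (L·n) y (glue (j, r))) = bpt n y j` — leaf-06's
   `par_bpt_glue_add_tstep` at zero steps), `legs`/`contour_zero` (the (1.7) legs = leaf-07's `contour … μ 0`);
 * §2 **`siteTr n M Rk x := Π_{b ∈ Γ_{y,x}} Rk_{ν(b)}(b)`** (ordered product along the legs) and `siteT Rg k := siteTr n_k M (Rg k)`;
   `siteTr_bpt` (= leaf-07's `transport (fine n M) (liftR Rk) μ (contour n M y j μ 0)` for every slot `μ`), `siteTr_one`;
 * §3 SIZE (k-uniform): `norm_siteT_sub_one_le : ‖siteT Rg k x − 1‖ ≤ e^{(d+1)α} − 1` and the operator form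
   **`opNorm_siteMul_siteT_sub_one_le : ‖siteMul (siteT Rg k) − 1‖ ≤ e^{(d+1)α} − 1`** (= `hT`), from `hreg` alone
   (`RegularTransportersContour.norm_transport_contour_sub_one_le_of_regular` at `s = 0`);
 * §4 TWO-LEVEL CONSISTENCY: `norm_siteT_succ_sub_par_le : ‖siteT Rg (k+1) x′ − siteT Rg k (par x′)‖ ≤ thetaC L n_k d (α/(L n_k)) (α/n_k)
   (βNE3/(L n_k²))` (row B3.b-conc (ii) = leaf-06's `transport_contour_two_level` at `t′ = 0`, coarse index `((r μ) + 0)/L = 0`, through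
   `RegularTransportersContour.transport_contour_two_level_of_regular`) and **`opNorm_siteMul_siteT_succ_sub_le`** (= `hTc` with
   `δT k := thetaC …`), and the GEOMETRIC forms `norm_siteT_succ_sub_par_le_geom` (`≤ θ₀/n_k`, the `SiteTransportLaws0.consistent` shape of
   row B4.e) / **`opNorm_siteMul_siteT_succ_sub_le_geom`** (`≤ θ₀·L^{−k}` = `hTc` ∧ `hδT` at once), `θ₀ = theta0 d α βNE3` = leaf-06's closed
   form (`thetaC_le_theta0_div`, row B3.b-conc (ii) file 3, couriered p210920), `theta0_nonneg_of_regular`.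
 * §5 the CONNECTION-NUMBER binders of the gauge-term chain (leaf-10's `connL`, used by `CovariantDivergencePlantingTower.planting_number_le`
   and `GaugeTermInstance.perturbationLaws_gaugeTerm_balaban`): `connL_eq_connTower` (`rfl`), **`norm_connL_le_of_regular`** (`hR`, α),
   **`norm_connL_tau_sub_le_of_regular`** (`hLip`, β/n_k), **`norm_connL_succ_sub_parT_le_of_localRate`** (`hcons`, βNE3/n_k from `hNE3`).

HONEST FRAMING (T4-DAG p. 1).  Bookkeeping at MODEL LEVEL: `Rg` is DATA (no assertion that it is Bałaban's minimiser `U_k(V)`; (3.19) is a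
SHAPE locator; no B0, c5); `hNE3` is node NE3's own predicate consumed BY NAME (c2/c7), nothing of NE3 proved; finite torus, operator norm;
constants OURS; two displayed binders of ROOT B's closure reduced to (hreg, hNE3); NOT [B9] (3.19)/(3.26) as printed; **NE2 NOT PROVED**; NOT
infinite volume, NOT a mass gap, NOT Clay, NOT summit progress; spine 0/9 unchanged.  HONEST DEPENDENCY: continuum YM on T⁴ ⇐ BetaPertH ∧
nine spine estimates (0/9 proved); BetaPertH ⇐ (D1) ∧ (D4) ∧ CAP+tail; G-an2-4 gates asym, D1 and NE2/3/4.  ABSOLUTE RULE kept; no `sorry`.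
-/

noncomputable section

open scoped BigOperators ComplexConjugate Matrix Matrix.Norms.L2Operator Kronecker

namespace Summit.QuantumFields.BalabanUV.T4Continuum.RegularSiteTransporters

open Literature.MathematicalPhysics.QuantumFieldTheory.Balaban1983to89.B5Prop11Plancherel (Tor fine)
open Literature.MathematicalPhysics.QuantumFieldTheory.Balaban1983to89.B5Block118 (bpt tstep tstep_zero)
open Literature.MathematicalPhysics.QuantumFieldTheory.Balaban1983to89.B5Blocks16 (bpt_bijective)
open Literature.MathematicalPhysics.QuantumFieldTheory.Balaban1983to89.B5G183RateUnitTower (lev lev_neZero)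
open Literature.MathematicalPhysics.QuantumFieldTheory.Balaban1983to89.T4EtaRateMin (LocalRate)
open Summit.QuantumFields.BalabanUV.T4Continuum
open Summit.QuantumFields.BalabanUV.T4Continuum.BalabanAveragedTowerModes (par)
open Summit.QuantumFields.BalabanUV.T4Continuum.BalabanAveragedTowerUnit (idx one_le_lev' lev_succ' cast_lev')
open Summit.QuantumFields.BalabanUV.T4Continuum.BlockMultiplication (siteMul siteMul_sub siteMul_one opNorm_siteMul_le)
open Summit.QuantumFields.BalabanUV.T4Continuum.NE2FromNE3 (bgReadings consistent_of_localRate_lev)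
open Summit.QuantumFields.BalabanUV.T4Continuum.CovariantBlockAveraging (transport leg corner contour)
open Summit.QuantumFields.BalabanUV.T4Continuum.LineAveragingPairing (glue glue_bijective par_bpt_glue_add_tstep)
open Summit.QuantumFields.BalabanUV.T4Continuum.NestedContourTransport (thetaC theta0 thetaC_le_theta0_div)
open Summit.QuantumFields.BalabanUV.T4Continuum.RegularBackgroundTower (RegularTransporters regClass betaNE3)
open Summit.QuantumFields.BalabanUV.T4Continuum.RegularTransportersContour
open Summit.QuantumFields.BalabanUV.T4Continuum.GaugeTermDecomposition (liftR connL)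
open Summit.QuantumFields.BalabanUV.T4Continuum.BlockPairingGeometry (tau parT)

variable {d : ℕ} {o : Type*} [Fintype o] [DecidableEq o]

/-! ## §1 Block decomposition, un-gluing, the legs of the (1.7) contour -/

section Blocks

variable (n L : ℕ) [NeZero n] [NeZero L] (M : Fin d → ℕ) [hM : ∀ μ, NeZero (M μ)]

/-- **the block decomposition** `x ↦ (y, j)` with `x = n·y + j` (inverse of `bpt`, (1.6)). [cite: Balaban1984PropagatorsI, (1.6) p.18 (shape)]
[folklore] -/
def bdec (x : Tor (fine n M)) : Tor M × (Fin d → Fin n) :=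
  (Equiv.ofBijective _ (bpt_bijective n M)).symm x

/-- `n·y + j` recovers `x`. [folklore] -/
theorem bpt_bdec (x : Tor (fine n M)) : bpt n M (bdec n M x).1 (bdec n M x).2 = x :=
  (Equiv.ofBijective _ (bpt_bijective n M)).apply_symm_apply x

/-- the decomposition of `n·y + j` is `(y, j)`. [folklore] -/
theorem bdec_bpt (y : Tor M) (j : Fin d → Fin n) : bdec n M (bpt n M y j) = (y, j) :=
  (Equiv.ofBijective _ (bpt_bijective n M)).symm_apply_apply (y, j)

omit hM in
/-- un-gluing an `(L·n)`-offset `j′ = L·j + r` into `(j, r)` (inverse of `LineAveragingPairing.glue`). [folklore] -/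
def unglue (j' : Fin d → Fin (L * n)) : (Fin d → Fin n) × (Fin d → Fin L) :=
  (Equiv.ofBijective _ (glue_bijective (d := d) n L)).symm j'

omit [NeZero n] hM in
/-- `glue (unglue j′) = j′`. [folklore] -/
theorem glue_unglue (j' : Fin d → Fin (L * n)) : glue n L (unglue n L j') = j' :=
  (Equiv.ofBijective _ (glue_bijective (d := d) n L)).apply_symm_apply j'

omit [NeZero n] hM in
/-- `unglue (glue p) = p`. [folklore] -/
theorem unglue_glue (p : (Fin d → Fin n) × (Fin d → Fin L)) : unglue n L (glue n L p) = p :=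
  (Equiv.ofBijective _ (glue_bijective (d := d) n L)).symm_apply_apply p

/-- **THE BLOCK PARENT OF A REFINED BLOCK POINT**: `par (bpt (L·n) y (L·j + r)) = bpt n y j` (leaf-06's `par_bpt_glue_add_tstep` at zero
steps; needs a direction to quote it, hence `d ≥ 1`). [folklore] -/
theorem par_bpt_glue (hd : 1 ≤ d) (y : Tor M) (j : Fin d → Fin n) (r : Fin d → Fin L) :
    par n L M (bpt (L * n) M y (glue n L (j, r))) = bpt n M y j := by
  have h := par_bpt_glue_add_tstep n L M y j r ⟨0, hd⟩ 0
  simp only [tstep_zero, add_zero, Nat.div_eq_of_lt (r ⟨0, hd⟩).isLt] at h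
  exact h

/-- the (1.7) LEGS `Γ_{y,x}` from the block base point `n·y` to `x = n·y + j`. [cite: Balaban1984PropagatorsI, (1.7) p.18 (shape)] [folklore] -/
def legs (y : Tor M) (j : Fin d → Fin n) : List (Tor (fine n M) × Fin d) :=
  (List.finRange d).flatMap fun ν : Fin d => leg n M ν (corner n M y j (ν : ℕ)) (j ν : ℕ)

omit [NeZero n] hM in
/-- the contour with ZERO line bonds is the legs. [folklore] -/
theorem contour_zero (y : Tor M) (j : Fin d → Fin n) (μ : Fin d) : contour n M y j μ 0 = legs n M y j := by
  have h : leg n M μ (bpt n M y j) 0 = [] := by simp [leg]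
  rw [contour, h, List.append_nil]
  rfl

end Blocks

/-! ## §2 The site transporters -/

section Site

variable (n : ℕ) [NeZero n] (M : Fin d → ℕ) [hM : ∀ μ, NeZero (M μ)]

/-- **THE SITE TRANSPORTER** `T(x) = Π_{b ∈ Γ_{y,x}} R_{ν(b)}(b)` of site-based bond transporters `Rk : Fin d → Tor (fine n M) → M_o(ℂ)` (ordered
product along the (1.7) legs; the `R(V(Γ_{y,x}))` of (3.19) at MODEL LEVEL). [cite: Balaban1985BackgroundPropagators, (3.19) p.393 (shape)]
[folklore] -/
def siteTr (Rk : Fin d → Tor (fine n M) → Matrix o o ℂ) (x : Tor (fine n M)) : Matrix o o ℂ :=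
  ((legs n M (bdec n M x).1 (bdec n M x).2).map fun b => Rk b.2 b.1).prod

/-- **AT A BLOCK POINT THE SITE TRANSPORTER IS leaf-07's CONTOUR TRANSPORTER WITH ZERO LINE BONDS**, read in any slot `μ` of the slot-lifted
data `liftR Rk`. [folklore] -/
theorem siteTr_bpt (Rk : Fin d → Tor (fine n M) → Matrix o o ℂ) (y : Tor M) (j : Fin d → Fin n) (μ : Fin d) :
    siteTr n M Rk (bpt n M y j) = transport (fine n M) (liftR (fine n M) Rk) μ (contour n M y j μ 0) := by
  rw [siteTr, bdec_bpt, contour_zero, transport]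
  rfl

/-- trivial transporters give the identity. [folklore] -/
theorem siteTr_one (x : Tor (fine n M)) : siteTr n M (fun _ _ => (1 : Matrix o o ℂ)) x = 1 := by
  rw [siteTr, List.map_const', List.prod_replicate, one_pow]

end Site

section Tower

variable (L : ℕ) [NeZero L] (M : Fin d → ℕ) [hM : ∀ μ, NeZero (M μ)]

/-- the site-transporter TOWER `T^{(k)} = siteTr n_k (Rg k)`. [folklore] -/
def siteT (Rg : (k : ℕ) → Fin d → (Tor (fine (lev L k) M) → Matrix o o ℂ)) (k : ℕ) : Tor (fine (lev L k) M) → Matrix o o ℂ :=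
  siteTr (lev L k) M (Rg k)

variable {L M}
variable {Rg : (k : ℕ) → Fin d → (Tor (fine (lev L k) M) → Matrix o o ℂ)} {α β : ℝ}

/-! ## §3 Size from the regularity class -/

/-- the block parent of a refined block point, at the tower levels `n_k ← n_{k+1} = L·n_k`. [folklore] -/
theorem par_bpt_glue_lev (hd : 1 ≤ d) (k : ℕ) (y : Tor M) (j : Fin d → Fin (lev L k)) (r : Fin d → Fin L) :
    par (lev L k) L M (bpt (lev L (k + 1)) M y (glue (lev L k) L (j, r))) = bpt (lev L k) M y j :=
  par_bpt_glue (lev L k) L M hd y j r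

/-- **SIZE, per site** (`d ≥ 1`, k-UNIFORM): `‖T^{(k)}(x) − 1‖ ≤ e^{(d+1)α} − 1`. [folklore] -/
theorem norm_siteT_sub_one_le (hd : 1 ≤ d) (hreg : RegularTransporters L M (fun k => liftR (fine (lev L k) M) (Rg k)) α β) (k : ℕ)
    (x : Tor (fine (lev L k) M)) : ‖siteT L M Rg k x - 1‖ ≤ Real.exp ((d + 1 : ℕ) * α) - 1 := by
  obtain ⟨⟨y, j⟩, rfl⟩ := (bpt_bijective (lev L k) M).2 x
  dsimp only
  rw [siteT, siteTr_bpt (lev L k) M (Rg k) y j ⟨0, hd⟩]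
  exact norm_transport_contour_sub_one_le_of_regular hreg k y ⟨0, hd⟩ j (Nat.zero_le _)

/-- **SIZE, operator form = the closure's binder `hT`**: `‖siteMul T^{(k)} − 1‖ ≤ e^{(d+1)α} − 1`. [folklore] -/
theorem opNorm_siteMul_siteT_sub_one_le (hd : 1 ≤ d) (hreg : RegularTransporters L M (fun k => liftR (fine (lev L k) M) (Rg k)) α β)
    (k : ℕ) : ‖siteMul (siteT L M Rg k) - 1‖ ≤ Real.exp ((d + 1 : ℕ) * α) - 1 := by
  have h0 : 0 ≤ Real.exp ((d + 1 : ℕ) * α) - 1 :=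
    sub_nonneg.mpr (Real.one_le_exp (mul_nonneg (Nat.cast_nonneg _) hreg.nonneg.1))
  rw [← siteMul_one, ← siteMul_sub]
  exact opNorm_siteMul_le _ h0 fun x => norm_siteT_sub_one_le hd hreg k x

/-! ## §4 Two-level consistency from the regularity class and node NE3 by name -/

/-- **TWO-LEVEL CONSISTENCY, per site** (`d ≥ 1`): `‖T^{(k+1)}(x′) − T^{(k)}(par x′)‖ ≤ thetaC L n_k d (α/(L·n_k)) (α/n_k) (βNE3/(L·n_k²))`
— row B3.b-conc (ii) at zero line bonds, fed by `hreg` and `hNE3`. [folklore] -/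
theorem norm_siteT_succ_sub_par_le (hd : 1 ≤ d) (hreg : RegularTransporters L M (fun k => liftR (fine (lev L k) M) (Rg k)) α β)
    {C : ℝ} (hC : 0 ≤ C) (hNE3 : LocalRate (bgReadings L M (regClass L M (fun k => liftR (fine (lev L k) M) (Rg k)))) C ((L : ℝ)⁻¹))
    (k : ℕ) (x' : Tor (fine (lev L (k + 1)) M)) :
    ‖siteT L M Rg (k + 1) x' - siteT L M Rg k (par (lev L k) L M x')‖
      ≤ thetaC L (lev L k) d (α / ((L : ℝ) * (lev L k : ℕ))) (α / (lev L k : ℕ)) (betaNE3 o C / ((L : ℝ) * ((lev L k : ℕ) : ℝ) ^ 2)) := by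
  obtain ⟨⟨y, j'⟩, rfl⟩ := (bpt_bijective (lev L (k + 1)) M).2 x'
  obtain ⟨⟨j, r⟩, rfl⟩ := (glue_bijective (d := d) (lev L k) L).2 j'
  dsimp only
  rw [par_bpt_glue_lev hd k y j r, siteT, siteT, siteTr_bpt (lev L (k + 1)) M (Rg (k + 1)) y _ ⟨0, hd⟩,
    siteTr_bpt (lev L k) M (Rg k) y j ⟨0, hd⟩]
  have h := transport_contour_two_level_of_regular hreg hC hNE3 k y ⟨0, hd⟩ j r 0
    (Nat.mul_pos (Nat.pos_of_ne_zero (NeZero.ne L)) (one_le_lev' L k))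
  simp only [Nat.add_zero, Nat.div_eq_of_lt (r ⟨0, hd⟩).isLt] at h
  exact h

/-- **TWO-LEVEL CONSISTENCY, operator form = the closure's binder `hTc`** with `δT k := thetaC L n_k d (α/(L·n_k)) (α/n_k) (βNE3/(L·n_k²))`
(geometric majorant `theta0·L^{−k}`: leaf-06's `thetaC_le_theta0_div`). Binders `hreg`, `hNE3` displayed; NE2 is NOT proved by this. [folklore] -/
theorem opNorm_siteMul_siteT_succ_sub_le (hd : 1 ≤ d) (hreg : RegularTransporters L M (fun k => liftR (fine (lev L k) M) (Rg k)) α β)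
    {C : ℝ} (hC : 0 ≤ C) (hNE3 : LocalRate (bgReadings L M (regClass L M (fun k => liftR (fine (lev L k) M) (Rg k)))) C ((L : ℝ)⁻¹))
    (k : ℕ) :
    ‖siteMul (siteT L M Rg (k + 1)) - siteMul (fun x' : Tor (fine (lev L (k + 1)) M) => siteT L M Rg k (par (lev L k) L M x'))‖
      ≤ thetaC L (lev L k) d (α / ((L : ℝ) * (lev L k : ℕ))) (α / (lev L k : ℕ)) (betaNE3 o C / ((L : ℝ) * ((lev L k : ℕ) : ℝ) ^ 2)) := by
  have h0 : 0 ≤ thetaC L (lev L k) d (α / ((L : ℝ) * (lev L k : ℕ))) (α / (lev L k : ℕ)) (betaNE3 o C / ((L : ℝ) * ((lev L k : ℕ) : ℝ) ^ 2)) :=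
    (norm_nonneg _).trans (norm_siteT_succ_sub_par_le hd hreg hC hNE3 k 0)
  rw [← siteMul_sub]
  exact opNorm_siteMul_le _ h0 fun x' => norm_siteT_succ_sub_par_le hd hreg hC hNE3 k x'

/-- **TWO-LEVEL CONSISTENCY, GEOMETRIC FORM, per site** (`d ≥ 1`): `‖T^{(k+1)}(x′) − T^{(k)}(par x′)‖ ≤ θ₀(d, α, βNE3)/n_k` — leaf-06's
closed-form bound `thetaC_le_theta0_div` (row B3.b-conc (ii) file 3, couriered by leaf-07) on top of `norm_siteT_succ_sub_par_le`; the
`SiteTransportLaws0.consistent` shape of row B4.e (leaf-01) with `τ′ = theta0 d α βNE3`. [folklore] -/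
theorem norm_siteT_succ_sub_par_le_geom (hd : 1 ≤ d) (hreg : RegularTransporters L M (fun k => liftR (fine (lev L k) M) (Rg k)) α β)
    {C : ℝ} (hC : 0 ≤ C) (hNE3 : LocalRate (bgReadings L M (regClass L M (fun k => liftR (fine (lev L k) M) (Rg k)))) C ((L : ℝ)⁻¹))
    (k : ℕ) (x' : Tor (fine (lev L (k + 1)) M)) :
    ‖siteT L M Rg (k + 1) x' - siteT L M Rg k (par (lev L k) L M x')‖ ≤ theta0 d α (betaNE3 o C) / (lev L k : ℕ) := by
  have hb : 0 ≤ betaNE3 o C := by unfold betaNE3; positivity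
  exact (norm_siteT_succ_sub_par_le hd hreg hC hNE3 k x').trans
    (thetaC_le_theta0_div (Nat.pos_of_ne_zero (NeZero.ne L)) (one_le_lev' L k) d hreg.nonneg.1 hb)

/-- **TWO-LEVEL CONSISTENCY, GEOMETRIC OPERATOR FORM = the closure's `hTc` ∧ `hδT` at once**: `‖siteMul T^{(k+1)} − siteMul (T^{(k)} ∘ par)‖ ≤
θ₀(d, α, βNE3)·L^{−k}` (`n_k = L^k`). Binders `hreg`, `hNE3` displayed; NE2 is NOT proved by this. [folklore] -/
theorem opNorm_siteMul_siteT_succ_sub_le_geom (hd : 1 ≤ d) (hreg : RegularTransporters L M (fun k => liftR (fine (lev L k) M) (Rg k)) α β)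
    {C : ℝ} (hC : 0 ≤ C) (hNE3 : LocalRate (bgReadings L M (regClass L M (fun k => liftR (fine (lev L k) M) (Rg k)))) C ((L : ℝ)⁻¹))
    (k : ℕ) :
    ‖siteMul (siteT L M Rg (k + 1)) - siteMul (fun x' : Tor (fine (lev L (k + 1)) M) => siteT L M Rg k (par (lev L k) L M x'))‖
      ≤ theta0 d α (betaNE3 o C) * ((L : ℝ)⁻¹) ^ k := by
  have h0 : 0 ≤ theta0 d α (betaNE3 o C) / (lev L k : ℕ) :=
    (norm_nonneg _).trans (norm_siteT_succ_sub_par_le_geom hd hreg hC hNE3 k 0)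
  rw [← siteMul_sub]
  refine (opNorm_siteMul_le _ h0 fun x' => norm_siteT_succ_sub_par_le_geom hd hreg hC hNE3 k x').trans (le_of_eq ?_)
  rw [cast_lev', inv_pow, div_eq_mul_inv]

/-- `θ₀ ≥ 0` as soon as the class is inhabited (it dominates a norm at level `0`). [folklore] -/
theorem theta0_nonneg_of_regular (hd : 1 ≤ d) (hreg : RegularTransporters L M (fun k => liftR (fine (lev L k) M) (Rg k)) α β)
    {C : ℝ} (hC : 0 ≤ C) (hNE3 : LocalRate (bgReadings L M (regClass L M (fun k => liftR (fine (lev L k) M) (Rg k)))) C ((L : ℝ)⁻¹)) :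
    0 ≤ theta0 d α (betaNE3 o C) := by
  have h := (norm_nonneg _).trans (opNorm_siteMul_siteT_succ_sub_le_geom hd hreg hC hNE3 0)
  simpa using h

/-! ## §5 The connection-number binders of the gauge-term chain (`connL`, leaf-10/leaf-05) from the same two hypotheses -/

omit [Fintype o] [NeZero L] hM in
/-- `connL` IS the connection tower of the slot-lifted transporters: `connL (fine n_k) n_k (Rg k) μ i = connTower (liftR ∘ Rg) k μ i`
(definitional). [folklore] -/
theorem connL_eq_connTower (k : ℕ) (μ : Fin d) (i : Tor (fine (lev L k) M) × Fin d) :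
    connL (fine (lev L k) M) ((lev L k : ℕ) : ℂ) (Rg k) μ i
      = RegularBackgroundTower.connTower L M (fun k => liftR (fine (lev L k) M) (Rg k)) k μ i := rfl

omit [NeZero L] hM in
/-- **SIZE binder `hR` of `GaugeTermInstance.perturbationLaws_gaugeTerm_balaban` / `CovariantDivergencePlantingTower.planting_number_le`**:
`‖connL … (Rg k) μ i‖ ≤ α` from `hreg`. [folklore] -/
theorem norm_connL_le_of_regular (hreg : RegularTransporters L M (fun k => liftR (fine (lev L k) M) (Rg k)) α β) (k : ℕ) (μ : Fin d)
    (i : Tor (fine (lev L k) M) × Fin d) : ‖connL (fine (lev L k) M) ((lev L k : ℕ) : ℂ) (Rg k) μ i‖ ≤ α :=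
  hreg.size k μ i

omit [NeZero L] hM in
/-- **LIPSCHITZ binder `hLip`**: `‖connL … μ (τ_λ i) − connL … μ i‖ ≤ β/n_k` from `hreg`. [folklore] -/
theorem norm_connL_tau_sub_le_of_regular (hreg : RegularTransporters L M (fun k => liftR (fine (lev L k) M) (Rg k)) α β) (k : ℕ)
    (μ lam : Fin d) (i : Tor (fine (lev L k) M) × Fin d) :
    ‖connL (fine (lev L k) M) ((lev L k : ℕ) : ℂ) (Rg k) μ (tau (fine (lev L k) M) lam i)
      - connL (fine (lev L k) M) ((lev L k : ℕ) : ℂ) (Rg k) μ i‖ ≤ β / (lev L k : ℕ) :=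
  RegularBackgroundTower.connTower_lipschitz hreg k μ lam i

/-- **CONSISTENCY binder `hcons` FROM NODE NE3 BY NAME**: `‖connL^{(k+1)} μ i′ − connL^{(k)} μ (parT i′)‖ ≤ βNE3/n_k`, `βNE3 = 2·card o·C`
(row B6 `consistent_of_localRate_lev` on `w ∈ regClass`). Nothing of NE3 is proved. [folklore] -/
theorem norm_connL_succ_sub_parT_le_of_localRate {C : ℝ} (hC : 0 ≤ C)
    (hNE3 : LocalRate (bgReadings L M (regClass L M (fun k => liftR (fine (lev L k) M) (Rg k)))) C ((L : ℝ)⁻¹)) (k : ℕ) (μ : Fin d)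
    (i' : Tor (fine (lev L (k + 1)) M) × Fin d) :
    ‖connL (fine (lev L (k + 1)) M) ((lev L (k + 1) : ℕ) : ℂ) (Rg (k + 1)) μ i'
      - connL (fine (lev L k) M) ((lev L k : ℕ) : ℂ) (Rg k) μ (parT (lev L k) L M i')‖ ≤ betaNE3 o C / (lev L k : ℕ) :=
  consistent_of_localRate_lev L M hC hNE3
    (Set.mem_insert _ _ : RegularBackgroundTower.connTower L M (fun k => liftR (fine (lev L k) M) (Rg k))
      ∈ regClass L M (fun k => liftR (fine (lev L k) M) (Rg k))) k μ i'

end Tower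

end Summit.QuantumFields.BalabanUV.T4Continuum.RegularSiteTransporters

end
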